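import Summits.ABC.IUTFork.Joshi.UntiltGaussNonIso
import Summits.ABC.IUTFork.Joshi.ATS1PerfectoidPreliminaries
import Mathlib.Analysis.Real.Cardinality
import HarnessLib

/-!
# Uncountably many pairwise non-homeomorphic untilts AS TYPED: [J-I] Rmk. 3.16.2 (E-t24's `ATS1.ExistsUncountablyManyNonTopIso`) hypothesis-free

Proof-only sequel (abc-iut cell, branch E, rung LADDER-ABC:A2.E; seat abc-iut-E-t55 g3) of `Joshi/UntiltGauss.lean` (p447273) and
`Joshi/UntiltGaussNonIso.lean` (p447732), over E-t1's `Untilt` / `Untilt.TopIso` (p428170), my `Untilt.TopEquiv.norm_eq_of_norm_p_eq`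
(p438930) and abc-iut-E-t24's typing of [J-I] Rmk. 3.16.2, `ATS1.ExistsUncountablyManyNonTopIso p :=
∃ S : Set (Untilt p), ¬ S.Countable ∧ S.Pairwise (¬ ·.TopIso ·)` (`Joshi/ATS1PerfectoidPreliminaries.lean`, p432511). BY NAME; no
definition of theirs touched, no `Prop` claim, no fact, no sorry.

Source and caveat: K. Joshi, arXiv 2106.11452 **v4** (UNREFEREED; typed AS A CANDIDATE, D-0012), Rmk. 3.16.2 p.16 l.5–7 «For the
existence of uncountably many topologically non-isomorphic perfectoid fields see the construction of inequivalent valuations given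
by [Schmidt, 1933] (sketched here in Section 11) or [Kaplansky, 1942, Theorem 8]»; Rmk. 3.16.3 p.16 l.8–12 («… with tilts isometric to
`ℂ_p^♭` …», [Kedlaya–Temkin 2018]) is the SAME-TILT statement and is NOT touched here: the Gauss untilts below have pairwise different
value groups, hence (Prop. 4.1.7 (1)) pairwise different tilts. What is proved is E-t24's typed sentence for E-t1's carrier `Untilt p`
(which records no tilt) — a construction in Mathlib's valuation theory, in the spirit of the remark's «inequivalent valuations», not a
reading of [Schmidt 1933] / [Kaplansky 1942].

WHAT IS PROVED.
* §A `exists_pow_norm_eq_gauss` — THE VALUE SET OF THE GAUSS UNTILT `Untilt.gauss p r hr`: every `y ≠ 0` has `‖y‖ⁿ = p^a · r^b` for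
  some `n ≥ 1`, `a b ∈ ℤ` (Gauss norms of polynomials are `|coeff|_p · rⁱ`, Mathlib `Polynomial.exists_eq_gaussNorm`; fractions;
  completion by density; the algebraic closure by `spectralNorm_eq_norm_coeff_zero_rpow`; completion again);
* §B `exists_rel_of_topIso` — the Gauss untilts `gaussExp p s` (radius `p^s`) and `gaussExp p t` are topologically isomorphic ONLY IF
  `n·t = a + b·s` for some `n ≥ 1`, `a, b ∈ ℤ` (both carry `‖p‖ = p⁻¹`, so a topological isomorphism is an isometry, p438930);
* §C **`ATS1.existsUncountablyManyNonTopIso_holds : ExistsUncountablyManyNonTopIso p`** — the classes of the equivalence relation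
  «`gaussExp p s` ≃_top `gaussExp p t`» on `ℝ` are countable (§B), `ℝ` is not (`Cardinal.not_countable_real`), so the quotient is
  uncountable and one representative Gauss untilt per class is an uncountable pairwise non-homeomorphic set.
Typed ≠ proved ≠ endorsed; no side taken on [IUTchIII] Cor. 3.12 or on any author. bears_on: LADDER-ABC:A2.E.
-/

noncomputable section

open Polynomial NNReal

namespace Summit.ABC.IUTFork.Joshi

variable (p : ℕ) [Fact p.Prime]

namespace GaussUntilt

/-! ## A. The value set of the Gauss untilt: `‖y‖ⁿ = p^a · r^b` -/

section ValueSet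

variable (r : ℝ)

/-- Products of values of the shape `p^a r^b`. [folklore] -/
theorem pr_mul (hr : 0 < r) {x y : ℝ} (hx : ∃ a b : ℤ, x = (p : ℝ) ^ a * r ^ b) (hy : ∃ a b : ℤ, y = (p : ℝ) ^ a * r ^ b) :
    ∃ a b : ℤ, x * y = (p : ℝ) ^ a * r ^ b := by
  obtain ⟨a, b, rfl⟩ := hx
  obtain ⟨c, d, rfl⟩ := hy
  have hp : (p : ℝ) ≠ 0 := by exact_mod_cast (Fact.out : p.Prime).ne_zero
  exact ⟨a + c, b + d, by rw [zpow_add₀ hp, zpow_add₀ hr.ne']; ring⟩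

omit [Fact p.Prime] in
/-- Inverses of values of the shape `p^a r^b`. [folklore] -/
theorem pr_inv {x : ℝ} (hx : ∃ a b : ℤ, x = (p : ℝ) ^ a * r ^ b) : ∃ a b : ℤ, x⁻¹ = (p : ℝ) ^ a * r ^ b := by
  obtain ⟨a, b, rfl⟩ := hx
  exact ⟨-a, -b, by rw [mul_inv, zpow_neg, zpow_neg]⟩

/-- Norms of nonzero `p`-adic numbers are powers of `p` (Mathlib `Padic.norm_eq_zpow_neg_valuation`). [folklore] -/
theorem pr_norm_padic {x : ℚ_[p]} (hx : x ≠ 0) : ∃ a b : ℤ, ‖x‖ = (p : ℝ) ^ a * r ^ b :=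
  ⟨-x.valuation, 0, by rw [Padic.norm_eq_zpow_neg_valuation hx, zpow_zero, mul_one]⟩

/-- The Gauss norm of a nonzero polynomial is `|aᵢ|_p · rⁱ` for some coefficient (`Polynomial.exists_eq_gaussNorm`). [folklore] -/
theorem pr_gaussNorm (hr : 0 < r) {f : ℚ_[p][X]} (hf : f ≠ 0) : ∃ a b : ℤ, f.gaussNorm (padicAbs p) r = (p : ℝ) ^ a * r ^ b := by
  obtain ⟨i, hi⟩ := Polynomial.exists_eq_gaussNorm (padicAbs p) r f
  have hne : f.gaussNorm (padicAbs p) r ≠ 0 := fun h =>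
    hf ((Polynomial.gaussNorm_eq_zero_iff (padicAbs p) f (fun x hx => by simpa [padicAbs_apply] using hx) hr).mp h)
  have hci : f.coeff i ≠ 0 := by
    intro h0
    rw [h0, map_zero, zero_mul] at hi
    exact hne hi
  rw [hi, padicAbs_apply]
  exact pr_mul p r hr (pr_norm_padic p r hci) ⟨0, i, by rw [zpow_zero, one_mul, zpow_natCast]⟩

/-- Value set of `ℚ_p(X)` under the Gauss absolute value (fractions `g/s`, `Valuation.extendToLocalization_mk'`). [folklore] -/
theorem pr_norm_GFun (hr : 0 < r) {f : GFun p r hr} (hf : f ≠ 0) : ∃ a b : ℤ, ‖f‖ = (p : ℝ) ^ a * r ^ b := by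
  rw [WithAbs.norm_eq_apply_ofAbs, gaussAbs_apply]
  have hf' : f.ofAbs ≠ 0 := by simpa using hf
  obtain ⟨⟨g, s⟩, hgs⟩ := IsLocalization.mk'_surjective (nonZeroDivisors ℚ_[p][X]) f.ofAbs
  simp only at hgs
  rw [← hgs, gaussValRat, Valuation.extendToLocalization_mk', NNReal.coe_mul, NNReal.coe_inv, coe_gaussVal, coe_gaussVal]
  have hg : g ≠ 0 := by
    rintro rfl
    apply hf'
    rw [← hgs, IsLocalization.mk'_zero]
  exact pr_mul p r hr (pr_gaussNorm p r hr hg) (pr_inv p r (pr_gaussNorm p r hr (nonZeroDivisors.ne_zero s.2)))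

omit [Fact p.Prime] in
/-- The value set of a completion of an ultrametric field is that of the field (density + the ultrametric equality
`norm_eq_of_norm_sub_lt'` of p447732). [folklore] -/
theorem pr_norm_completion {A : Type} [NormedField A] [IsUltrametricDist A]
    (h : ∀ a : A, a ≠ 0 → ∃ m b : ℤ, ‖a‖ = (p : ℝ) ^ m * r ^ b)
    {y : UniformSpace.Completion A} (hy : y ≠ 0) : ∃ a b : ℤ, ‖y‖ = (p : ℝ) ^ a * r ^ b := by
  haveI := isUltrametricDist_completion A
  have hpos : 0 < ‖y‖ := norm_pos_iff.mpr hy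
  obtain ⟨x, hx⟩ := (UniformSpace.Completion.denseRange_coe (α := A)).exists_dist_lt y hpos
  rw [dist_eq_norm, ← norm_neg, neg_sub] at hx
  have hxy : ‖(x : UniformSpace.Completion A)‖ = ‖y‖ := norm_eq_of_norm_sub_lt' hx
  have hx0 : x ≠ 0 := by
    rintro rfl
    rw [UniformSpace.Completion.coe_zero, norm_zero] at hxy
    exact hpos.ne' hxy.symm
  rw [← hxy, UniformSpace.Completion.norm_coe]
  exact h x hx0

/-- Value set of `GFunHat`. [folklore] -/
theorem pr_norm_GFunHat (hr : 0 < r) {y : GFunHat p r hr} (hy : y ≠ 0) : ∃ a b : ℤ, ‖y‖ = (p : ℝ) ^ a * r ^ b :=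
  pr_norm_completion p r (fun _ ha => pr_norm_GFun p r hr ha) hy

/-- Value set of `GAlgCl`: `‖x‖ⁿ = ‖a₀‖` with `n = deg minpoly`, `a₀` its constant coefficient (spectral norm,
`spectralNorm_eq_norm_coeff_zero_rpow`). [folklore] -/
theorem exists_pow_pr_norm_GAlgCl (hr : 0 < r) {x : GAlgCl p r hr} (hx : x ≠ 0) :
    ∃ n : ℕ, 0 < n ∧ ∃ a b : ℤ, ‖x‖ ^ n = (p : ℝ) ^ a * r ^ b := by
  have hint : IsIntegral (GFunHat p r hr) x := (Algebra.IsAlgebraic.isAlgebraic x).isIntegral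
  have hn0 : 0 < (minpoly (GFunHat p r hr) x).natDegree := minpoly.natDegree_pos hint
  have ha0 : (minpoly (GFunHat p r hr) x).coeff 0 ≠ 0 := minpoly.coeff_zero_ne_zero hint hx
  refine ⟨_, hn0, ?_⟩
  have h1 : ‖x‖ = ‖(minpoly (GFunHat p r hr) x).coeff 0‖ ^ (1 / ((minpoly (GFunHat p r hr) x).natDegree : ℝ)) :=
    spectralNorm.spectralNorm_eq_norm_coeff_zero_rpow (GFunHat p r hr) (GAlgCl p r hr) x
  rw [h1, one_div, Real.rpow_inv_natCast_pow (norm_nonneg _) hn0.ne']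
  exact pr_norm_GFunHat p r hr ha0

/-- Value set of `GField` (density again). [folklore] -/
theorem exists_pow_pr_norm_GField (hr : 0 < r) {y : GField p r hr} (hy : y ≠ 0) :
    ∃ n : ℕ, 0 < n ∧ ∃ a b : ℤ, ‖y‖ ^ n = (p : ℝ) ^ a * r ^ b := by
  have hpos : 0 < ‖y‖ := norm_pos_iff.mpr hy
  obtain ⟨x, hx⟩ := (UniformSpace.Completion.denseRange_coe (α := GAlgCl p r hr)).exists_dist_lt y hpos
  rw [dist_eq_norm, ← norm_neg, neg_sub] at hx
  have hxy : ‖(x : GField p r hr)‖ = ‖y‖ := norm_eq_of_norm_sub_lt' hx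
  have hx0 : x ≠ 0 := by
    rintro rfl
    rw [UniformSpace.Completion.coe_zero, norm_zero] at hxy
    exact hpos.ne' hxy.symm
  obtain ⟨n, hn, a, b, hab⟩ := exists_pow_pr_norm_GAlgCl p r hr hx0
  exact ⟨n, hn, a, b, by rw [← hxy, UniformSpace.Completion.norm_coe, hab]⟩

/-- **THE VALUE SET OF THE GAUSS UNTILT**: every nonzero `y ∈ Untilt.gauss p r hr` has `‖y‖ⁿ = p^a · r^b` for some `n ≥ 1`,
`a, b ∈ ℤ` (so its value group is the divisible hull of `p^ℤ r^ℤ` — cf. [J-I] Prop. 4.1.7 (1)). [folklore] -/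
theorem exists_pow_norm_eq_gauss (hr : 0 < r) (y : (Untilt.gauss p r hr).K) (hy : y ≠ 0) :
    ∃ n : ℕ, 0 < n ∧ ∃ a b : ℤ, ‖y‖ ^ n = (p : ℝ) ^ a * r ^ b :=
  exists_pow_pr_norm_GField p r hr hy

end ValueSet

/-! ## B. Separation of two Gauss untilts -/

/-- `0 < p^s`. [folklore] -/
theorem rpow_pos' (s : ℝ) : 0 < (p : ℝ) ^ s := Real.rpow_pos_of_pos (by exact_mod_cast (Fact.out : p.Prime).pos) s

/-- **`gaussExp p s`** — the Gauss untilt of radius `p^s` (reducible synonym of `Untilt.gauss`). [folklore] -/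
abbrev gaussExp (s : ℝ) : Untilt p := Untilt.gauss p ((p : ℝ) ^ s) (rpow_pos' p s)

/-- **Separation**: `gaussExp p s` and `gaussExp p t` are topologically isomorphic ONLY IF `n·t = a + b·s` for some `n ≥ 1`,
`a, b ∈ ℤ`: both carry `‖p‖ = p⁻¹`, so a topological isomorphism is an ISOMETRY (p438930) and the element of norm `p^t`
(`Untilt.exists_norm_eq_gauss`) lands in the value set of `gaussExp p s` (§A); `p^·` is injective. [folklore] -/
theorem exists_rel_of_topIso {s t : ℝ} (h : (gaussExp p s).TopIso (gaussExp p t)) :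
    ∃ n : ℕ, 0 < n ∧ ∃ a b : ℤ, (n : ℝ) * t = a + b * s := by
  have hp0 : 0 < (p : ℝ) := by exact_mod_cast (Fact.out : p.Prime).pos
  have hp1 : 1 < (p : ℝ) := by exact_mod_cast (Fact.out : p.Prime).one_lt
  obtain ⟨e⟩ := h
  have hpp : ‖(p : (gaussExp p s).K)‖ = ‖(p : (gaussExp p t).K)‖ := by
    rw [Untilt.norm_p_gauss, Untilt.norm_p_gauss]
  have hiso := Untilt.TopEquiv.norm_eq_of_norm_p_eq e hpp
  obtain ⟨T, hT⟩ := Untilt.exists_norm_eq_gauss p ((p : ℝ) ^ t) (rpow_pos' p t)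
  obtain ⟨y, hyT⟩ : ∃ y : (gaussExp p s).K, e.toRingEquiv y = T := ⟨_, e.toRingEquiv.apply_symm_apply T⟩
  have hty : ‖y‖ = (p : ℝ) ^ t := by rw [← hiso y, hyT]; exact hT
  have hy0 : y ≠ 0 := by
    intro h0
    rw [h0, norm_zero] at hty
    exact (rpow_pos' p t).ne' hty.symm
  obtain ⟨n, hn, a, b, hab⟩ := exists_pow_norm_eq_gauss p ((p : ℝ) ^ s) (rpow_pos' p s) y hy0
  refine ⟨n, hn, a, b, ?_⟩
  rw [hty, ← Real.rpow_natCast, ← Real.rpow_mul hp0.le, ← Real.rpow_intCast, ← Real.rpow_intCast,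
    ← Real.rpow_mul hp0.le, ← Real.rpow_add hp0] at hab
  have hinj : t * n = (a : ℝ) + s * b := by
    by_contra hne
    rcases lt_or_gt_of_ne hne with hlt | hlt
    · exact (Real.rpow_lt_rpow_of_exponent_lt hp1 hlt).ne hab
    · exact (Real.rpow_lt_rpow_of_exponent_lt hp1 hlt).ne hab.symm
  linarith

/-! ## C. Uncountably many pairwise non-homeomorphic Gauss untilts -/

/-- Topological isomorphism of `gaussExp p s`, `gaussExp p t` as an equivalence relation on exponents `s, t ∈ ℝ` (E-t1's
`TopIso.refl/symm/trans`). [folklore] -/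
def expRel : Setoid ℝ where
  r s t := (gaussExp p s).TopIso (gaussExp p t)
  iseqv := ⟨fun _ => Untilt.TopIso.refl _, fun h => h.symm, fun h h' => h.trans h'⟩

/-- Each class is countable: by §B it lies in the countable set `{(a + b·s)/n}`. [folklore] -/
theorem countable_class (s : ℝ) : {t | (expRel p) s t}.Countable := by
  have hsub : {t | (expRel p) s t} ⊆
      Set.range (fun q : ℕ × ℤ × ℤ => ((q.2.1 : ℝ) + q.2.2 * s) / ((q.1 : ℝ) + 1)) := by
    intro t ht
    obtain ⟨n, hn, a, b, hab⟩ := exists_rel_of_topIso p ht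
    refine ⟨(n - 1, a, b), ?_⟩
    have hn' : ((n - 1 : ℕ) : ℝ) + 1 = n := by
      rw [Nat.cast_sub hn, Nat.cast_one]; ring
    show ((a : ℝ) + b * s) / (((n - 1 : ℕ) : ℝ) + 1) = t
    rw [hn', ← hab, mul_div_cancel_left₀ t (by exact_mod_cast hn.ne')]
  exact (Set.countable_range _).mono hsub

/-- The quotient is uncountable: `ℝ` (uncountable, `Cardinal.not_countable_real`) is the union of the classes of the
representatives `Quotient.out`. [folklore] -/
theorem not_countable_quotient : ¬ (Set.univ : Set (Quotient (expRel p))).Countable := by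
  intro hc
  apply Cardinal.not_countable_real
  have : (Set.univ : Set ℝ) = ⋃ q ∈ (Set.univ : Set (Quotient (expRel p))), {t | (expRel p) q.out t} := by
    ext t
    simp only [Set.mem_univ, Set.mem_iUnion, Set.mem_setOf_eq, exists_true_left, true_iff]
    exact ⟨Quotient.mk (expRel p) t, Quotient.mk_out t⟩
  rw [this]
  exact hc.biUnion fun q _ => countable_class p q.out

/-- One Gauss untilt per class. [folklore] -/
def repUntilt (q : Quotient (expRel p)) : Untilt p := gaussExp p q.out

/-- Distinct classes have NON-homeomorphic representatives. [folklore] -/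
theorem not_topIso_repUntilt {q q' : Quotient (expRel p)} (hne : q ≠ q') :
    ¬ (repUntilt p q).TopIso (repUntilt p q') := fun h =>
  hne (by rw [← Quotient.out_eq q, ← Quotient.out_eq q']; exact Quotient.sound h)

/-- The representative map is injective (`TopIso` is reflexive). [folklore] -/
theorem repUntilt_injective : Function.Injective (repUntilt p) := fun q q' h => by
  by_contra hne
  exact not_topIso_repUntilt p hne (h ▸ Untilt.TopIso.refl _)

/-- **[J-I] Rmk. 3.16.2 AS TYPED, HYPOTHESIS-FREE** (v4 p.16 l.5–7 «the existence of uncountably many topologically non-isomorphic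
perfectoid fields»): E-t24's `ATS1.ExistsUncountablyManyNonTopIso p` — an uncountable set of E-t1-untilts, pairwise NOT topologically
isomorphic (the representatives of the classes of §C). CAVEAT: pairwise different tilts; not Rmk. 3.16.3's same-tilt statement
(module docstring). [claim: Joshi2021ATS1, status: disputed] -/
theorem _root_.Summit.ABC.IUTFork.Joshi.ATS1.existsUncountablyManyNonTopIso_holds :
    ATS1.ExistsUncountablyManyNonTopIso p := by
  refine ⟨Set.range (repUntilt p), ?_, ?_⟩
  · intro hc
    apply not_countable_quotient p
    haveI : Countable (Set.range (repUntilt p)) := hc.to_subtype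
    haveI : Countable (Quotient (expRel p)) :=
      Function.Injective.countable (f := fun q : Quotient (expRel p) => (⟨repUntilt p q, q, rfl⟩ : Set.range (repUntilt p)))
        fun q q' h => repUntilt_injective p (congrArg Subtype.val h)
    exact Set.countable_univ
  · rintro _ ⟨q, rfl⟩ _ ⟨q', rfl⟩ hne
    exact not_topIso_repUntilt p fun h => hne (h ▸ rfl)

end GaussUntilt

end Summit.ABC.IUTFork.Joshi

end
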